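import Literature.RingTheory.CompleteLocalRings.WittVectorEmbedding
import Literature.FieldTheory.AlgClosed.EmbeddingIntoComplex
import Literature.FieldTheory.AlgClosed.AutomorphismExtension
import Mathlib.RingTheory.Localization.Cardinality
import Mathlib.FieldTheory.IsAlgClosed.AlgebraicClosure
import HarnessLib

/-!
# Cassels' embedding theorem with a compatible complex embedding of `Frac W(κ)`

Topic `Literature/RingTheory/CompleteLocalRings`. The form of Cassels' embedding theorem used in
"reduction modulo `p`" arguments for COMPLEX varieties (Maulik–Poonen 2012, §4; the classical
device "choose an isomorphism `ℂ ≅ ℂ_p` / an embedding of the `p`-adic field into `ℂ` compatible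
with the given finitely generated field"): for a finitely generated integral domain `R ⊆ ℂ`, for all
large primes `p` and every algebraically closed field `κ` of characteristic `p` of cardinality at
most the continuum, there are an injective ring map `φ : R → W(κ)` AND a ring map
`ι : Frac W(κ) → ℂ` with `ι ∘ φ = (R ⊆ ℂ)`.

* `exists_ringHom_fractionRing_comp_eq` — the complex embedding: given an injective
  `φ : R → W(κ)` (`R` countable) and an injective `j : R → ℂ`, some `ι : Frac W(κ) → ℂ` satisfies
  `ι ∘ φ = j`. Proof: `#Frac W(κ) ≤ #κ^ℵ₀ ≤ 𝔠`, so `Frac W(κ)` embeds into `ℂ` by Steinitz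
  (`AlgClosed.nonempty_ringHom_complex_of_cardinalMk_le_continuum`); the two resulting embeddings
  of the countable field `Frac R` into `ℂ` are conjugate under `Aut(ℂ)`
  (`AlgClosed.exists_ringEquiv_apply_eq`).
* `exists_injective_ringHom_wittVector_comp_eq` — combination with
  `exists_injective_ringHom_wittVector`.

## References

* [Cassels1976] J. W. S. Cassels, An embedding theorem for fields, Bull. Austral. Math. Soc. 14
  (1976), Thm. I.
* [MaulikPoonen2012] D. Maulik, B. Poonen, Néron–Severi groups under specialization, Duke Math.
  J. 161 (2012), §4.
-/

noncomputable section

open Cardinal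

namespace Literature.RingTheory.CompleteLocalRings

open Literature.FieldTheory.AlgClosed

/-- `#W(κ) ≤ 𝔠` when `#κ ≤ 𝔠`: a Witt vector is a sequence of elements of `κ`. [folklore] -/
private theorem cardinalMk_wittVector_le {p : ℕ} {κ : Type} [CommRing κ] (hκ : #κ ≤ 𝔠) :
    #(WittVector p κ) ≤ 𝔠 := by
  have e : WittVector p κ ≃ (ℕ → κ) :=
    { toFun := fun x => x.coeff
      invFun := fun f => WittVector.mk p f
      left_inv := fun x => by ext n; rfl
      right_inv := fun f => rfl }
  rw [Cardinal.mk_congr e, ← Cardinal.power_def, Cardinal.mk_nat]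
  calc #κ ^ ℵ₀ ≤ 𝔠 ^ ℵ₀ := power_le_power_right hκ
    _ = 𝔠 := continuum_power_aleph0

/-- **A complex embedding of `Frac W(κ)` compatible with a given embedding of a countable subring**
(the "choose `ℂ ≅ ℂ_p` compatibly" step of reduction-mod-`p` arguments, e.g. Maulik–Poonen 2012 §4).
Let `κ` be an integral domain of characteristic `p` with `#κ ≤ 𝔠`, `R` a countable integral domain,
`φ : R → W(κ)` and `j : R → ℂ` injective ring maps. Then there is a ring map `ι : Frac W(κ) → ℂ` with
`ι (φ r) = j r` for all `r`. Proof: `Frac W(κ)` has characteristic zero and cardinality `≤ 𝔠`, hence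
embeds into `ℂ` (Steinitz); composing, `Frac R` acquires two embeddings into `ℂ`, which differ by an
automorphism of `ℂ` since `Frac R` is countable (`AlgClosed.exists_ringEquiv_apply_eq`).
[cite: MaulikPoonen2012, §4] -/
theorem exists_ringHom_fractionRing_comp_eq {R : Type} [CommRing R] [IsDomain R] [Countable R]
    {p : ℕ} [Fact p.Prime] {κ : Type} [CommRing κ] [IsDomain κ] [CharP κ p] (hκ : #κ ≤ 𝔠)
    (φ : R →+* WittVector p κ) (hφ : Function.Injective φ) (j : R →+* ℂ)
    (hj : Function.Injective j) :
    ∃ ι : FractionRing (WittVector p κ) →+* ℂ,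
      ∀ r : R, ι (algebraMap (WittVector p κ) (FractionRing (WittVector p κ)) (φ r)) = j r := by
  haveI : CharZero (WittVector p κ) := charZero_wittVector p κ
  set K := FractionRing (WittVector p κ) with hK
  haveI : CharZero K :=
    charZero_of_injective_algebraMap (IsFractionRing.injective (WittVector p κ) K)
  -- `Frac W(κ)` embeds into `ℂ`
  have hKc : #K ≤ 𝔠 :=
    (IsLocalization.cardinalMk_le (L := K) (nonZeroDivisors (WittVector p κ))).trans
      (cardinalMk_wittVector_le hκ)
  obtain ⟨ι₀⟩ := nonempty_ringHom_complex_of_cardinalMk_le_continuum K hKc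
  -- the two embeddings of `Frac R` into `ℂ`
  set F := FractionRing R with hF
  have hφ' : Function.Injective ((algebraMap (WittVector p κ) K).comp φ) :=
    (IsFractionRing.injective (WittVector p κ) K).comp hφ
  let i' : F →+* K := IsFractionRing.lift hφ'
  let j' : F →+* ℂ := IsFractionRing.lift hj
  have hFc : #F ≤ ℵ₀ :=
    (IsLocalization.cardinalMk_le (L := F) (nonZeroDivisors R)).trans mk_le_aleph0
  have hΩ : ℵ₀ < #ℂ := by rw [Cardinal.mk_complex]; exact Cardinal.aleph0_lt_continuum
  obtain ⟨σ, hσ⟩ := exists_ringEquiv_apply_eq hΩ hFc (ι₀.comp i') j'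
  refine ⟨σ.toRingHom.comp ι₀, fun r => ?_⟩
  have h1 : algebraMap (WittVector p κ) K (φ r) = i' (algebraMap R F r) := by
    rw [IsFractionRing.lift_algebraMap]; rfl
  rw [h1, RingHom.comp_apply]
  change σ ((ι₀.comp i') (algebraMap R F r)) = j r
  rw [hσ, IsFractionRing.lift_algebraMap]

/-- **Cassels' embedding theorem with a compatible complex embedding.** Let `R` be an integral domain,
finitely generated as a ring, with an injective ring map `j : R → ℂ`. There is `N₀` such that for
every prime `p ≥ N₀` and every algebraically closed field `κ` of characteristic `p` with `#κ ≤ 𝔠`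
(e.g. `𝔽̄_p`) there are an injective ring map `φ : R → W(κ)` and a ring map `ι : Frac W(κ) → ℂ` with
`ι ∘ φ = j` (`exists_injective_ringHom_wittVector` + `exists_ringHom_fractionRing_comp_eq`).
[cite: Cassels1976, Thm. I] [cite: MaulikPoonen2012, §4] -/
theorem exists_injective_ringHom_wittVector_comp_eq (R : Type) [CommRing R] [IsDomain R]
    [Algebra.FiniteType ℤ R] (j : R →+* ℂ) (hj : Function.Injective j) :
    ∃ N₀ : ℕ, ∀ (p : ℕ) [Fact p.Prime], N₀ ≤ p →
      ∀ (κ : Type) [Field κ] [IsAlgClosed κ] [CharP κ p], #κ ≤ 𝔠 →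
        ∃ (φ : R →+* WittVector p κ) (ι : FractionRing (WittVector p κ) →+* ℂ),
          Function.Injective φ ∧
          ∀ r : R, ι (algebraMap (WittVector p κ) (FractionRing (WittVector p κ)) (φ r)) = j r := by
  haveI : CharZero R := j.charZero
  haveI : Countable R := by
    obtain ⟨s, hs⟩ := Algebra.FiniteType.out (R := ℤ) (A := R)
    have hc : (Set.univ : Set R).Countable := by
      rw [← Algebra.coe_top (R := ℤ) (A := R), ← hs, Algebra.adjoin_eq_range,
        AlgHom.coe_range]
      haveI : Countable (MvPolynomial (s : Set R) ℤ) := by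
        rw [← Cardinal.mk_le_aleph0_iff]
        refine MvPolynomial.cardinalMk_le_max_lift.trans (max_le (max_le ?_ ?_) le_rfl)
        · rw [Cardinal.lift_le_aleph0, Cardinal.mk_le_aleph0_iff]; infer_instance
        · rw [Cardinal.lift_le_aleph0, Cardinal.mk_le_aleph0_iff]; infer_instance
      exact Set.countable_range _
    exact Set.countable_univ_iff.mp hc
  obtain ⟨N₀, hN₀⟩ := exists_injective_ringHom_wittVector R
  refine ⟨N₀, fun p _ hp κ _ _ _ hκ => ?_⟩
  obtain ⟨φ, hφ⟩ := hN₀ p hp κ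
  obtain ⟨ι, hι⟩ := exists_ringHom_fractionRing_comp_eq hκ φ hφ j hj
  exact ⟨φ, ι, hφ, hι⟩

end Literature.RingTheory.CompleteLocalRings

end
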